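import Summits.BirchSwinnertonDyer.BirchSwinnertonDyer.Theorems.EisensteinPrimesIndexPlumbingDictionary
import HarnessLib

/-!
# Crux `GoodLatticeBDPValue` (stmt-BirchSwinnertonDyer-19032), line `halves` v20, stub `stub_indexInputs`:
# the COT conjuncts — the STRICT residual-type Selmer groups over `K_∞` are `p`-primary with finite `p`-torsion

Width seat bsd-line-x1-p1-w5 (gen 0, 2026-08-28), sequel of `…IndexPlumbingDictionary` (p648073). The v20
input stub `stub_indexInputs` (LEAD g4) carries six COT conjuncts in `H¹`-language — for
`A ∈ {(F/𝒪)(θsub), E_K[p^∞], (F/𝒪)(θquot)}`: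
`hprim : ∀ s : datumStrictSelmer (ker κ) A p (bdpData A p vbar) ↑Sf, ∃ n, p ^ n • s = 0` and
`hfin : Finite ((datumStrictSelmer (ker κ) A p (bdpData A p vbar) ↑Sf)[p])` — the hypotheses `hprim₁₂₃`,
and (via `Finite` instances) the finiteness the mid-level composition
`ResidualIndexAssembly.zpCorank_datumStrictSelmer_add_eq` needs. This file derives them, sorry-free, from the
COTORSION packages the line already holds at the point of use (KY Thm. 1.4.1 (i)–(ii): for `f` the residual
dévissage `Thm141TorsionClauses…`, for `θ` the [RH] + [PWL-θ] packages `hSsub/hSquot :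
∀ D : DatumDualData …, Module.Finite ∧ IsTorsion ∧ μ = 0`):

* §1 (any `K`, `κ`, `p`-primary discrete `M`, data `L`, `S₀`): `hprim` for every subgroup of `H¹(K_∞, M)`;
  `isPrimary_and_finite_torsionBy_datumStrictSelmer_of_datumDualData` — if some dual datum of the
  NON-strict group `S^{S₀}_M(K_∞)` is f.g. torsion with `μ = 0` then the STRICT group (a subgroup,
  `datumStrictSelmer_le_datumSelmer`) is `p`-primary with finite `p`-torsion (the dictionary's
  `finite_torsionBy_and_lambdaInvariant_datumDualData_eq_zpCorank` + `primary_and_finite_torsionBy_of_injective`).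
* §2 characters `θ : Γ_K → ℤ_p^×` (`charModule ∅ θ`): from ONE dual datum, and from the `∀`-package shape
  (one dual datum exists: `KellerYin2024.nonempty_unrDualData_char`); plus the `∀`-package form of the
  `λ`-dictionary `λ(D.X) = zpCorank S^{S₀}_nr(θ)`.
* §3 the curve `E_K = W.baseChange K` at the crux's binders (`K` imaginary quadratic, `vbar ∋ p`,
  `Sf = {w ∣ N_W}`): from the three antecedents of `𝔛^{Sf}_f = AcSelmer.XAc E_K p κ vbar ↑Sf γ`
  (the dictionary's `selmerAc = datumStrictSelmer`).

No new definition, no named fact, no `sorry`; no statement of the crux / KY Thm. 1.4.1 is proved here.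

References: T. Keller, M. Yin, arXiv:2402.12781v2, Thm. 1.2.2 and Thm. 1.4.1; R. Greenberg, V. Vatsal,
Invent. Math. 142 (2000), §2 pp. 15–21; R. Greenberg, LNM 1716 (1999), §1 p. 60; F. Castella, Camb. J. Math. 6
(2018), Def. 2.2.
-/

-- D-0017: single-problem summit, the namespace repeats the problem name by design.
set_option linter.dupNamespace false
set_option autoImplicit false

noncomputable section

open scoped Classical AddSubgroup

open NumberField IsDedekindDomain Field
open Literature.NumberTheory.EllipticCurves Literature.NumberTheory.EllipticCurves.GreenbergSelmer
  Literature.NumberTheory.EllipticCurves.GreenbergVatsal2000 Literature.NumberTheory.GaloisRepresentations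
  Literature.NumberTheory.EllipticCurves.Castella2018 IsDedekindDomain.HeightOneSpectrum

namespace Summit.BirchSwinnertonDyer.BirchSwinnertonDyer.Theorems.IndexInputsCot

open Summit.BirchSwinnertonDyer.BirchSwinnertonDyer.Theorems
  Summit.BirchSwinnertonDyer.BirchSwinnertonDyer.Theorems.IndexPlumbingDictionary

/-! ## §1 Generic: strict ≤ non-strict, and a cotorsion dual of the non-strict group -/

section Cot

variable {K : Type} [Field K] [NumberField K] {p : ℕ} [Fact p.Prime] (κ : ZpExtension K p)
  (M : Type) [AddCommGroup M] [DistribMulAction (absoluteGaloisGroup K) M] [TopologicalSpace M]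
  [DiscreteTopology M]

/-- Every class in ANY subgroup `X ≤ H¹(K_∞, M)` is killed by a power of `p` when `M` is `p`-primary
(`Gal(K̄/K_∞)` compact, `M` discrete): the `hprim` conjuncts of `stub_indexInputs` for all three strict
groups at once. [cite: GreenbergLNM1716, §1 (after Conj. 1.3)] -/
theorem exists_pow_smul_eq_zero_of_addSubgroup_subgroupH1 (hM : ∀ m : M, ∃ k : ℕ, p ^ k • m = 0)
    (X : AddSubgroup (subgroupH1 κ.kerSubgroup M)) (s : X) : ∃ n : ℕ, p ^ n • s = 0 := by
  obtain ⟨k, hk⟩ := exists_pow_smul_subgroupH1_eq_zero κ M hM (s : subgroupH1 κ.kerSubgroup M)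
  exact ⟨k, Subtype.ext (by rw [AddSubgroupClass.coe_nsmul]; exact hk)⟩

variable (γ : absoluteGaloisGroup K) (L : Data K M p) (S₀ : Set (HeightOneSpectrum (𝓞 K)))

/-- **`S^{S₀,str}_M(K_∞)` is `p`-primary with FINITE `p`-torsion** as soon as the NON-strict group
`S^{S₀}_M(K_∞) ⊇ S^{S₀,str}_M(K_∞)` has a Pontryagin-dual datum which is finitely generated and torsion
over `Λ` with `μ = 0` (`M` `p`-primary): the dictionary gives `S^{S₀}_M(K_∞)[p]` finite, and a subgroup of
a `p`-primary group with finite `p`-torsion is such (`primary_and_finite_torsionBy_of_injective` along the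
inclusion `datumStrictSelmer_le_datumSelmer`). [cite: GreenbergVatsal2000, §2 pp. 15, 20–21]
[cite: GreenbergLNM1716, §1 p. 60] -/
theorem isPrimary_and_finite_torsionBy_datumStrictSelmer_of_datumDualData
    (D : DatumDualData κ γ M L S₀) (hM : ∀ m : M, ∃ k : ℕ, p ^ k • m = 0)
    [Module.Finite (IwasawaAlgebra p) D.X] (htor : Module.IsTorsion (IwasawaAlgebra p) D.X)
    (hμ : muInvariant p D.X = 0) :
    (∀ s : datumStrictSelmer κ.kerSubgroup M p L S₀, ∃ n : ℕ, p ^ n • s = 0) ∧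
      Finite ((datumStrictSelmer κ.kerSubgroup M p L S₀)[(p : ℤ)]) := by
  haveI := (finite_torsionBy_and_lambdaInvariant_datumDualData_eq_zpCorank κ γ M L S₀ D hM htor hμ).1
  have hle : datumStrictSelmer κ.kerSubgroup M p L S₀ ≤ datumSelmerInfty κ M L S₀ :=
    datumStrictSelmer_le_datumSelmer κ.kerSubgroup M p L S₀
  exact primary_and_finite_torsionBy_of_injective (i := AddSubgroup.inclusion hle)
    (AddSubgroup.inclusion_injective hle)
    (exists_pow_smul_eq_zero_of_addSubgroup_subgroupH1 κ M hM (datumSelmerInfty κ M L S₀))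

end Cot

/-! ## §2 Characters `θ : Γ_K → ℤ_p^×` -/

section CotChar

variable {K : Type} [Field K] [NumberField K] (p : ℕ) [Fact p.Prime]
  (vbar : HeightOneSpectrum (𝓞 K)) (κ : ZpExtension K p) (γ : absoluteGaloisGroup K)
  (θ : FramedGaloisRep K (padicCoeffIntegers (∅ : Set (PadicAlgCl p))) 1)
  (S₀ : Set (HeightOneSpectrum (𝓞 K)))

/-- **COT for `A = (F/𝒪)(θ)` in `stub_indexInputs`' types (`hprim₁ ∧ hfin₁`, `hprim₃ ∧ hfin₃`)**: for a
character `θ : Γ_K → ℤ_p^×` and the crux's local data `bdpData … vbar`, if SOME dual datum of the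
unramified-at-`v̄` group `S^{S₀}_nr(θ) = unrSelmer κ ((F/𝒪)(θ)) vbar S₀` is finitely generated torsion
with `μ = 0` (KY Thm. 1.4.1 (i)–(ii); in the line: [RH] + [PWL-θ], the `hSsub/hSquot` packages), then
`R(θ) = datumStrictSelmer (ker κ) ((F/𝒪)(θ)) p (bdpData … vbar) S₀` is `p`-primary with finite `p`-torsion.
[cite: KellerYin2024, Thm. 1.4.1 (i)–(ii) (arXiv:2402.12781v2)] [cite: GreenbergVatsal2000, §2 pp. 20–21] -/
theorem isPrimary_and_finite_torsionBy_datumStrictSelmer_charModule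
    (DS : DatumDualData κ γ (KellerYin2024.charModule ∅ θ)
      (AcSelmer.bdpData (KellerYin2024.charModule ∅ θ) p vbar) S₀)
    [Module.Finite (IwasawaAlgebra p) DS.X] (htor : Module.IsTorsion (IwasawaAlgebra p) DS.X)
    (hμ : muInvariant p DS.X = 0) :
    (∀ s : datumStrictSelmer κ.kerSubgroup (KellerYin2024.charModule ∅ θ) p
        (AcSelmer.bdpData (KellerYin2024.charModule ∅ θ) p vbar) S₀, ∃ n : ℕ, p ^ n • s = 0) ∧
      Finite ((datumStrictSelmer κ.kerSubgroup (KellerYin2024.charModule ∅ θ) p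
        (AcSelmer.bdpData (KellerYin2024.charModule ∅ θ) p vbar) S₀)[(p : ℤ)]) :=
  isPrimary_and_finite_torsionBy_datumStrictSelmer_of_datumDualData κ (KellerYin2024.charModule ∅ θ) γ _
    S₀ DS (exists_pow_smul_cofree_eq_zero (∅ : Set (PadicAlgCl p)) θ) htor hμ

/-- The same from the line's `∀`-PACKAGE shape `∀ D : DatumDualData …, Module.Finite ∧ IsTorsion ∧ μ = 0`
(how `hSsub/hSquot` are held in the composition), via the existence of one dual datum for a character
module (`KellerYin2024.nonempty_unrDualData_char`).
[cite: KellerYin2024, Thm. 1.2.2 and Thm. 1.4.1 (i)–(ii) (arXiv:2402.12781v2)] [cite: GreenbergVatsal2000, §2 pp. 17, 20–21] -/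
theorem isPrimary_and_finite_torsionBy_datumStrictSelmer_charModule_of_forall [Fact (κ.IsTopGenerator γ)]
    (hS : ∀ D : DatumDualData κ γ (KellerYin2024.charModule ∅ θ)
        (AcSelmer.bdpData (KellerYin2024.charModule ∅ θ) p vbar) S₀,
      Module.Finite (IwasawaAlgebra p) D.X ∧ Module.IsTorsion (IwasawaAlgebra p) D.X ∧
        muInvariant p D.X = 0) :
    (∀ s : datumStrictSelmer κ.kerSubgroup (KellerYin2024.charModule ∅ θ) p
        (AcSelmer.bdpData (KellerYin2024.charModule ∅ θ) p vbar) S₀, ∃ n : ℕ, p ^ n • s = 0) ∧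
      Finite ((datumStrictSelmer κ.kerSubgroup (KellerYin2024.charModule ∅ θ) p
        (AcSelmer.bdpData (KellerYin2024.charModule ∅ θ) p vbar) S₀)[(p : ℤ)]) := by
  obtain ⟨DS⟩ := KellerYin2024.nonempty_unrDualData_char (∅ : Set (PadicAlgCl p)) θ κ vbar S₀
    (Fact.out : κ.IsTopGenerator γ)
  obtain ⟨hfg, htor, hμ⟩ := hS DS
  exact isPrimary_and_finite_torsionBy_datumStrictSelmer_charModule p vbar κ γ θ S₀ DS htor hμ

/-- The `λ`-dictionary from the `∀`-package shape: `λ(D.X) = zpCorank S^{S₀}_nr(θ)` for EVERY dual datum `D`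
of `S^{S₀}_nr(θ)`, given `∀ D, Module.Finite ∧ IsTorsion ∧ μ = 0`. [cite: GreenbergVatsal2000, §2 p. 21]
[cite: KellerYin2024, Thm. 1.4.1 (iii) (arXiv:2402.12781v2)] -/
theorem lambdaInvariant_datumDualData_charModule_eq_zpCorank_of_forall
    (hS : ∀ D : DatumDualData κ γ (KellerYin2024.charModule ∅ θ)
        (AcSelmer.bdpData (KellerYin2024.charModule ∅ θ) p vbar) S₀,
      Module.Finite (IwasawaAlgebra p) D.X ∧ Module.IsTorsion (IwasawaAlgebra p) D.X ∧
        muInvariant p D.X = 0)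
    (D : DatumDualData κ γ (KellerYin2024.charModule ∅ θ)
      (AcSelmer.bdpData (KellerYin2024.charModule ∅ θ) p vbar) S₀) :
    lambdaInvariant p D.X =
      zpCorank (datumSelmerInfty κ (KellerYin2024.charModule ∅ θ)
        (AcSelmer.bdpData (KellerYin2024.charModule ∅ θ) p vbar) S₀) p := by
  obtain ⟨hfg, htor, hμ⟩ := hS D
  exact (finite_torsionBy_and_lambdaInvariant_datumDualData_charModule_eq_zpCorank p K vbar κ γ θ S₀ D
    htor hμ).2

end CotChar

/-! ## §3 The curve `E_K = W.baseChange K` at the crux's binders -/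

section CotCurve

variable (W : WeierstrassCurve ℚ) [W.IsElliptic] (p : ℕ) [Fact p.Prime]
  (K : Type) [Field K] [NumberField K] (vbar : HeightOneSpectrum (𝓞 K)) (κ : ZpExtension K p)
  (Sf : Finset (HeightOneSpectrum (𝓞 K)))

/-- **COT for `A = E_K[p^∞]` in `stub_indexInputs`' types (`hprim₂ ∧ hfin₂`)**: at the crux's data
(`K` imaginary quadratic, `vbar ∋ p`, `Sf = {w ∣ N_W}`), if `𝔛^{Sf}_f = AcSelmer.XAc E_K p κ vbar ↑Sf γ` is
finitely generated torsion over `Λ` with `μ = 0` (KY Thm. 1.4.1 (i)–(ii) for `f`; in the line: the residual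
dévissage, `Thm141TorsionClauses…`), then `R(E_K[p^∞]) = datumStrictSelmer (ker κ) E_K[p^∞] p (bdpData … vbar) ↑Sf`
is `p`-primary with finite `p`-torsion (the dictionary: it IS `Sel_{v̄}^{Sf}(K_∞, E_K[p^∞])`).
[cite: KellerYin2024, Thm. 1.4.1 (i)–(ii) (arXiv:2402.12781v2)] [cite: Castella2018, Def. 2.2 (arXiv:1704.06608 p. 5)] -/
theorem isPrimary_and_finite_torsionBy_datumStrictSelmer_curve (hK : IsImaginaryQuadratic K)
    (hvbar : ((p : ℕ) : 𝓞 K) ∈ vbar.asIdeal) (γ : absoluteGaloisGroup K) [Fact (κ.IsTopGenerator γ)]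
    (hSf : ∀ w : HeightOneSpectrum (𝓞 K), w ∈ Sf ↔ ((W.conductorNorm ℤ : ℤ) : 𝓞 K) ∈ w.asIdeal)
    [Module.Finite (IwasawaAlgebra p)
      (AcSelmer.XAc (W.baseChange K) p κ vbar (↑Sf : Set (HeightOneSpectrum (𝓞 K))) γ)]
    (htor : Module.IsTorsion (IwasawaAlgebra p)
      (AcSelmer.XAc (W.baseChange K) p κ vbar (↑Sf : Set (HeightOneSpectrum (𝓞 K))) γ))
    (hμ : muInvariant p (AcSelmer.XAc (W.baseChange K) p κ vbar (↑Sf : Set (HeightOneSpectrum (𝓞 K))) γ) = 0) :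
    (∀ s : datumStrictSelmer κ.kerSubgroup ↥((W.baseChange K).geomPrimaryTorsion p) p
        (AcSelmer.bdpData ↥((W.baseChange K).geomPrimaryTorsion p) p vbar)
        (↑Sf : Set (HeightOneSpectrum (𝓞 K))), ∃ n : ℕ, p ^ n • s = 0) ∧
      Finite ((datumStrictSelmer κ.kerSubgroup ↥((W.baseChange K).geomPrimaryTorsion p) p
        (AcSelmer.bdpData ↥((W.baseChange K).geomPrimaryTorsion p) p vbar)
        (↑Sf : Set (HeightOneSpectrum (𝓞 K))))[(p : ℤ)]) :=
  ⟨exists_pow_smul_eq_zero_of_addSubgroup_subgroupH1 κ _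
      ((W.baseChange K).exists_pow_smul_geomPrimaryTorsion_eq_zero p) _,
    (finite_torsionBy_and_lambdaInvariant_XAc_eq_zpCorank_datumStrictSelmer W p K vbar κ Sf hK hvbar γ hSf
      htor hμ).1⟩

end CotCurve

end Summit.BirchSwinnertonDyer.BirchSwinnertonDyer.Theorems.IndexInputsCot

end
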